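import Literature.Analysis.FluidPDE.NSLocalLerayBackwardUniquenessCKN
import HarnessLib

/-!
# Backward uniqueness for local Leray solutions on a slab with an arbitrary datum
# (Lemarié-Rieusset 2016, Thm. 15.4, the `L³` hypothesis on the datum removed)

Analysis/FluidPDE proof file (theorems only: no definition, no named fact, no `sorry`).

The tree proves Lemarié-Rieusset's Thm. 15.4 on a slab
(`lemarieRieusset_backward_uniqueness_slab_holds`, `NSLocalLerayBackwardUniquenessCKN.lean`;
P. G. Lemarié-Rieusset, *The Navier–Stokes Problem in the 21st Century* (2016), Thm. 15.4, PDF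
p. 568) along the route of Escauriaza–Seregin–Šverák 2003, §5 = Seregin 2012, §4: far-field
regularity and far-field backward uniqueness of the vorticity, Caffarelli–Kohn–Nirenberg's
partial regularity, bounded strips around regular times, spatial unique continuation, and the
Liouville theorem for bounded curl- and divergence-free fields. As printed, Thm. 15.4 assumes the
datum `u₀ ∈ L³(ℝ³)`, and the tree's statement carries `MemLp u₀ 3 volume`. **On that route the
`L³` hypothesis is never used**: it is threaded only into the far-field `L^∞` bound
`leray_solution_farField_bound_slab` (Thm. 14.5), whose discharge
`leray_solution_farField_bound_slab_holds` (`LerayFarFieldRegularityHolds.lean`) ignores it — the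
far-field bound holds for every local Leray solution on a slab, from the decay clause (7) of the
class, the decay of the gauged pressure (`IsLocalLeraySolutionOn.tendsto_lintegral_pressure_sub_average`,
"any viscosity and any datum") and the ε-regularity criterion Thm. 14.4
(`lemarieRieusset_epsilon_regularity_holds`). This file records the resulting statement of
Thm. 15.4 **for an arbitrary (weakly divergence-free) datum**, which is the form needed when the
datum is only in weak-`L³` — the blow-down limits in Albritton–Barker's Liouville theorem
(J. Math. Fluid Mech. 21 (2019), Thm. 4.1, data bounded in `L^{3,∞}` along `t_k ↓ −∞`; the limit
datum of the rescaled solutions lies in `L^{3,∞} ⊄ L³`), on the discharge path of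
`Literature.Analysis.FluidPDE.AlbrittonBarker2019_liouville_weakL3_backward`
(`AncientL3BackwardLiouville.lean`):

* `IsLocalLeraySolutionOn.farField_bound_anyDatum` — Thm. 14.5 on a slab, any viscosity, any
  datum (one line from the tree's `farField_bound_of_pressure_decay`);
* `localLeray_farField_curl_eq_zero_slab_anyDatum` — Steps 2–3 of the proof of Thm. 15.4 on a
  slab (the far-field vorticity of a local Leray solution vanishing at the final time is zero),
  verbatim the tree's `localLeray_farField_vorticity_eq_zero_slab_of_higherRegularityBounds`
  (`NSLocalLerayFarFieldVorticityBypass.lean`) with the far-field bound taken from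
  `farField_bound_anyDatum` instead of the `L³`-datum fact;
* `IsLocalLeraySolutionOn.ae_zero_of_final_vanishing_unit_anyDatum`,
  `IsLocalLeraySolutionOn.ae_zero_of_final_vanishing_anyDatum` — Thm. 15.4 on a slab without the
  `L³` hypothesis (unit viscosity, resp. `ν > 0` by the slab viscosity scaling), verbatim the
  tree's `ae_zero_of_final_vanishing_unit` / `ae_zero_of_final_vanishing` with the two far-field
  inputs replaced as above.

Nothing accepted is restated or changed: the named fact `lemarieRieusset_backward_uniqueness_slab`
keeps its printed `L³` hypothesis; the theorems here are strict generalisations of its discharge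
(which they give back by forgetting the hypothesis).

## Mathlib / tree search

`lean search 'anyDatum|ae_zero_of_final_vanishing|farField_curl_eq_zero'`: only the `L³`-datum
versions quoted above (2026-08-17). Reused by name: `exists_farField_representative`,
`farField_curl_eq_zero`, `preimage_rescale_farField`,
`iteratedFDeriv_slice_comp_continuousLinearEquiv`, `ae_forall_isRegularPoint_slab`,
`exists_strip_bound_Ioo`, `ae_zero_strip_of_farField_curl_eq_zero`,
`NSBoundedHigherRegularityBounds_holds`, `kangMiuraTsai_local_pressure_bound_holds`,
`lemarieRieusset_epsilon_regularity_holds`, `IsLocalLeraySolutionOn.farField_bound_of_pressure_decay`,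
`.memLp_setAverage_pressure`, `.tendsto_lintegral_pressure_sub_average`, `.toUnitViscosity`.

## References

* P. G. Lemarié-Rieusset, *The Navier–Stokes Problem in the 21st Century*, CRC Press (2016),
  doi:10.1201/b19556: Thm. 15.4 (PDF p. 568) and its proof (pp. 568–569); Thm. 14.5 (p. 510).
  [`LemarieRieusset2016`]
* L. Escauriaza, G. Seregin, V. Šverák, Russ. Math. Surveys 58:2 (2003) 211–250, §3, Thm. 4.1,
  Thm. 5.1, §5. [`EscauriazaSereginSverak2003`]
* G. Seregin, Comm. Math. Phys. 312 (2012) 833–845 = arXiv:1104.3615, §4. [`Seregin2012CMP`]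
* D. Albritton, T. Barker, J. Math. Fluid Mech. 21 (2019), Paper No. 43 = arXiv:1811.00502, §4,
  Thm. 4.1 and Prop. 4.2 (the consumer: weak-`L³` data). [`AlbrittonBarker2019`]
-/

noncomputable section

open MeasureTheory TopologicalSpace Set Function Filter Metric
open _root_.Topology
open scoped ENNReal NNReal InnerProductSpace RealInnerProductSpace

namespace Literature.Analysis.FluidPDE

/-! ### Thm. 14.5 on a slab for an arbitrary datum -/

/-- **Far-field `L^∞` bound of a local Leray solution on a slab, any viscosity, any datum**
(Lemarié-Rieusset 2016, proof of Thm. 14.5, PDF pp. 510–512, and proof of Thm. 15.4, Step 2,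
p. 569; Bradshaw–Tsai 2020, §1): for a local Leray solution `(v, π)` on `(0, T) × ℝ³` with
viscosity `ν > 0` and `0 < t₁`, `t₂ ≤ T`, there is `R` with `v` essentially bounded on
`(t₁, t₂) × {|x| > R}`. The tree's `farField_bound_of_pressure_decay` (ε-regularity, Thm. 14.4)
fed with the mean gauge `c_{x₀}(t) = ⨍_{B_{3/2}(x₀)} π(t)` and the pressure decay
`tendsto_lintegral_pressure_sub_average`; no hypothesis on the datum enters.
[cite: LemarieRieusset2016, proof of Thm. 14.5 (PDF pp. 510–512) and of Thm. 15.4, Step 2 (p. 569)] -/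
theorem IsLocalLeraySolutionOn.farField_bound_anyDatum {T ν : ℝ} (hν : 0 < ν)
    {u₀ : EuclideanSpace ℝ (Fin 3) → EuclideanSpace ℝ (Fin 3)}
    {v : ℝ → EuclideanSpace ℝ (Fin 3) → EuclideanSpace ℝ (Fin 3)}
    {π : ℝ → EuclideanSpace ℝ (Fin 3) → ℝ} (hv : IsLocalLeraySolutionOn T ν u₀ v π)
    {t₁ t₂ : ℝ} (ht₁ : 0 < t₁) (ht₂T : t₂ ≤ T) :
    ∃ R : ℝ, eLpNorm (uncurry v) ∞
      (volume.restrict (Ioo t₁ t₂ ×ˢ (closedBall (0 : EuclideanSpace ℝ (Fin 3)) R)ᶜ)) < ∞ :=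
  hv.farField_bound_of_pressure_decay lemarieRieusset_epsilon_regularity_holds hν
    (c := fun x₀ t => ⨍ y in ball x₀ (3 / 2), π t y)
    (fun x₀ => hv.memLp_setAverage_pressure x₀ (by norm_num))
    hv.tendsto_lintegral_pressure_sub_average ht₁ ht₂T

/-! ### Steps 2–3 of the proof of Thm. 15.4 on a slab, arbitrary datum -/

set_option maxHeartbeats 800000 in
/-- **The far-field vorticity of a local Leray solution vanishing at the final time is zero —
arbitrary datum** (Lemarié-Rieusset 2016, proof of Thm. 15.4, Steps 2–3, PDF pp. 568–569;
Escauriaza–Seregin–Šverák 2003, §3 (3.31)–(3.32) with Thm. 5.1): for a local Leray solution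
`(u, p)` on `(0, T₁) × ℝ³` with viscosity `ν > 0` and weakly divergence-free datum (no
integrability assumption on the datum beyond the class), whose pairings with test fields tend to
`0` as `t ↑ T₁`, and every `T₄ ∈ (0, T₁)`, there are `R` and a representative `U` of `u` on
`(T₄, T₁) × {x₃ > R}`, `C¹` in space, with `curl U(t, ·) = 0` there. The proof is, word for word,
that of the tree's `localLeray_farField_vorticity_eq_zero_slab_of_higherRegularityBounds` (the
far-field representative `exists_farField_representative`, the Navier–Stokes rescaling to unit
viscosity and the window `]-1, 0[`, and the `C¹ ∩ {∂ₓω ∈ C¹}` backward uniqueness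
`farField_curl_eq_zero`), except that the far-field `L^∞` bound of Step 2 is
`farField_bound_anyDatum`. [cite: LemarieRieusset2016, proof of Thm. 15.4, Steps 2–3 (PDF pp. 568–569)] [cite: EscauriazaSereginSverak2003, §3 (3.31)–(3.32) and Thm. 5.1] -/
theorem localLeray_farField_curl_eq_zero_slab_anyDatum (hB : NSBoundedHigherRegularityBounds)
    {ν T₁ : ℝ} (hν : 0 < ν)
    {u₀ : EuclideanSpace ℝ (Fin 3) → EuclideanSpace ℝ (Fin 3)}
    {u : ℝ → EuclideanSpace ℝ (Fin 3) → EuclideanSpace ℝ (Fin 3)}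
    {p : ℝ → EuclideanSpace ℝ (Fin 3) → ℝ}
    (hdiv : IsWeaklyDivFree u₀) (hu : IsLocalLeraySolutionOn T₁ ν u₀ u p)
    (hfinal : ∀ φ : EuclideanSpace ℝ (Fin 3) → EuclideanSpace ℝ (Fin 3),
      FunctionSpaces.IsTestFunctionOn (⊤ : Opens (EuclideanSpace ℝ (Fin 3))) φ →
        Tendsto (fun t => ∫ x, ⟪u t x, φ x⟫) (𝓝[<] T₁) (𝓝 0))
    {T₄ : ℝ} (hT₄ : T₄ ∈ Ioo 0 T₁) :
    ∃ (R : ℝ) (U : ℝ → EuclideanSpace ℝ (Fin 3) → EuclideanSpace ℝ (Fin 3)),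
      (∀ t ∈ Ioo T₄ T₁, ContDiffOn ℝ 1 (U t) {x : EuclideanSpace ℝ (Fin 3) | R < x 2}) ∧
        uncurry U =ᵐ[volume.restrict
          (Ioo T₄ T₁ ×ˢ {x : EuclideanSpace ℝ (Fin 3) | R < x 2})] uncurry u ∧
        ∀ t ∈ Ioo T₄ T₁, ∀ x : EuclideanSpace ℝ (Fin 3), R < x 2 → curl (U t) x = 0 := by
  -- ### Step 2: the far-field bound and the far-field representative
  have ht₁ : (0 : ℝ) < T₄ / 2 := by linarith [hT₄.1]
  obtain ⟨R₀, hbd⟩ := hu.farField_bound_anyDatum hν ht₁ (le_refl T₁)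
  set R : ℝ := max R₀ 0 + 1 with hRdef
  have hR₀R : R₀ < R := by rw [hRdef]; linarith [le_max_left R₀ 0]
  have hRpos : 0 < R := by rw [hRdef]; linarith [le_max_right R₀ 0]
  obtain ⟨K, U, hae, -, hCD, hjc, hbdK⟩ := exists_farField_representative hB
    kangMiuraTsai_local_pressure_bound_holds hν hdiv hu ht₁ le_rfl hbd
    (by linarith [hT₄.1] : T₄ / 2 < T₄) hT₄.2 hR₀R 4
  set S : Set (EuclideanSpace ℝ (Fin 3)) := (closedBall (0 : EuclideanSpace ℝ (Fin 3)) R)ᶜ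
    with hSdef
  have hSo : IsOpen S := isClosed_closedBall.isOpen_compl
  set Ω : Set (ℝ × EuclideanSpace ℝ (Fin 3)) := Ioo T₄ T₁ ×ˢ S with hΩdef
  have hΩo : IsOpen Ω := isOpen_Ioo.prod hSo
  -- a nonnegative bound
  set K₀ : ℝ := max K 0 with hK₀def
  have hK₀ : 0 ≤ K₀ := le_max_right _ _
  have hbdK' : ∀ n ≤ 4, ∀ w ∈ Ω, ‖iteratedFDeriv ℝ n (U w.1) w.2‖ ≤ K₀ := fun n hn w hw =>
    (hbdK n hn w hw).trans (le_max_left _ _)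
  -- smoothness of the slices on `S`
  have hUS : ∀ t ∈ Ioo T₄ T₁, ContDiffOn ℝ 4 (U t) S := fun t ht x hx =>
    ((hCD (t, x) ⟨ht, hx⟩).of_le (by norm_cast)).contDiffWithinAt
  -- `(U, p)` solves the equations in `𝒟'(Ω)` with viscosity `ν`
  have hle : (⟨Ω, hΩo⟩ : Opens (ℝ × EuclideanSpace ℝ (Fin 3))) ≤
      slab (EuclideanSpace ℝ (Fin 3)) (Ioo 0 T₁) isOpen_Ioo := fun w hw =>
    mem_slab.2 ⟨hT₄.1.trans hw.1.1, hw.1.2⟩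
  have hsolU : IsDistributionalNSSolutionOn ⟨Ω, hΩo⟩ ν 0 U p :=
    (hu.distributional.of_le hle).congr_ae hae.symm (ae_of_all _ fun _ => rfl)
  -- ### Step 3: the Navier–Stokes rescaling to unit viscosity and the window `]-1, 0[`
  set β : ℝ := T₁ - T₄ with hβdef
  have hβ : 0 < β := sub_pos.2 hT₄.2
  set γ : ℝ := Real.sqrt (ν * β) with hγdef
  have hγ : 0 < γ := Real.sqrt_pos.2 (mul_pos hν hβ)
  have hγ0 : γ ≠ 0 := hγ.ne'
  have hγ2 : γ ^ 2 = ν * β := Real.sq_sqrt (mul_pos hν hβ).le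
  set α : ℝ := γ / ν with hαdef
  have hα : 0 < α := div_pos hγ hν
  have hαγ : β = α * γ := by
    rw [hαdef, div_mul_eq_mul_div, ← sq, hγ2]
    field_simp
  have hvisc : α * ν / γ = 1 := by
    rw [hαdef]
    field_simp
  have hαγ0 : α * γ ≠ 0 := mul_ne_zero hα.ne' hγ0
  -- the map `Φ`
  set Φ : ℝ × EuclideanSpace ℝ (Fin 3) → ℝ × EuclideanSpace ℝ (Fin 3) :=
    fun z => (T₁ + β * z.1, γ • z.2) with hΦdef
  have hΦst : stAffine β γ T₁ (0 : EuclideanSpace ℝ (Fin 3)) = Φ := by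
    funext z
    simp [stAffine, hΦdef]
  have hΦc : Continuous Φ := by
    rw [hΦdef]
    fun_prop
  -- the rescaled region
  set R' : ℝ := R / γ with hR'def
  have hR' : 0 ≤ R' := (div_pos hRpos hγ).le
  set S' : Set (EuclideanSpace ℝ (Fin 3)) := (closedBall (0 : EuclideanSpace ℝ (Fin 3)) R')ᶜ
    with hS'def
  have hS'o : IsOpen S' := isClosed_closedBall.isOpen_compl
  set Ω' : Set (ℝ × EuclideanSpace ℝ (Fin 3)) := Ioo (-1 : ℝ) 0 ×ˢ S' with hΩ'def
  have hΩ'o : IsOpen Ω' := isOpen_Ioo.prod hS'o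
  have hpre : Φ ⁻¹' Ω = Ω' := by
    rw [hΦdef, hΩdef, hSdef, hΩ'def, hS'def, hR'def, hβdef]
    exact preimage_rescale_farField hT₄.2 hγ
  have hmaps : MapsTo Φ Ω' Ω := fun z hz => by
    have : z ∈ Φ ⁻¹' Ω := by rw [hpre]; exact hz
    exact this
  have hΦ1 : ∀ z : ℝ × EuclideanSpace ℝ (Fin 3), (Φ z).1 = T₁ + β * z.1 := fun z => rfl
  have hΦ2 : ∀ z : ℝ × EuclideanSpace ℝ (Fin 3), (Φ z).2 = γ • z.2 := fun z => rfl
  have hmaps1 : ∀ z ∈ Ω', T₁ + β * z.1 ∈ Ioo T₄ T₁ := fun z hz => (hmaps hz).1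
  have hmaps2 : ∀ z ∈ Ω', γ • z.2 ∈ S := fun z hz => (hmaps hz).2
  have hmapsγ : MapsTo (fun y : EuclideanSpace ℝ (Fin 3) => γ • y) S' S := by
    intro y hy
    rw [hS'def, mem_compl_iff, mem_closedBall, dist_zero_right, not_le, hR'def,
      div_lt_iff₀ hγ] at hy
    rw [hSdef, mem_compl_iff, mem_closedBall, dist_zero_right, not_le, norm_smul,
      Real.norm_of_nonneg hγ.le]
    linarith [mul_comm ‖y‖ γ]
  -- the rescaled fields
  obtain ⟨U', hU'def⟩ : ∃ U' : ℝ → EuclideanSpace ℝ (Fin 3) → EuclideanSpace ℝ (Fin 3),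
      U' = α • stPull β γ T₁ (0 : EuclideanSpace ℝ (Fin 3)) U := ⟨_, rfl⟩
  obtain ⟨w, hwdef⟩ : ∃ w : ℝ → EuclideanSpace ℝ (Fin 3) → EuclideanSpace ℝ (Fin 3),
      w = α • stPull β γ T₁ (0 : EuclideanSpace ℝ (Fin 3)) u := ⟨_, rfl⟩
  obtain ⟨π', hπ'def⟩ : ∃ π' : ℝ → EuclideanSpace ℝ (Fin 3) → ℝ,
      π' = α ^ 2 • stPull β γ T₁ (0 : EuclideanSpace ℝ (Fin 3)) p := ⟨_, rfl⟩
  have hU'app : ∀ s y, U' s y = α • U (T₁ + β * s) (γ • y) := fun s y => by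
    rw [hU'def]
    simp [smul_stPull_apply]
  have hwapp : ∀ s y, w s y = α • u (T₁ + β * s) (γ • y) := fun s y => by
    rw [hwdef]
    simp [smul_stPull_apply]
  -- the linear change of variables `e y = γ y`
  set e : EuclideanSpace ℝ (Fin 3) ≃L[ℝ] EuclideanSpace ℝ (Fin 3) :=
    ContinuousLinearEquiv.equivOfInverse
      (γ • ContinuousLinearMap.id ℝ (EuclideanSpace ℝ (Fin 3)))
      (γ⁻¹ • ContinuousLinearMap.id ℝ (EuclideanSpace ℝ (Fin 3)))
      (fun y => by simp [smul_smul, hγ0]) (fun y => by simp [smul_smul, hγ0]) with hedef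
  have he : ∀ y, e y = γ • y := fun y => rfl
  have henorm : ‖(e : EuclideanSpace ℝ (Fin 3) →L[ℝ] EuclideanSpace ℝ (Fin 3))‖ ≤ γ := by
    refine ContinuousLinearMap.opNorm_le_bound _ hγ.le fun y => ?_
    rw [ContinuousLinearEquiv.coe_coe, he y, norm_smul, Real.norm_of_nonneg hγ.le]
  have hU'fun : ∀ s, U' s = α • (U (T₁ + β * s) ∘ ⇑e) := fun s => by
    funext y
    rw [hU'app]
    rfl
  -- the formula for `D_yⁿ U'(s, ·)` at the points of `Ω'`
  have hformula : ∀ n : ℕ, ∀ z ∈ Ω', iteratedFDeriv ℝ n (U' z.1) z.2 =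
      α • (iteratedFDeriv ℝ n (U (T₁ + β * z.1)) (γ • z.2)).compContinuousLinearMap
        fun _ => (e : EuclideanSpace ℝ (Fin 3) →L[ℝ] EuclideanSpace ℝ (Fin 3)) := by
    intro n z hz
    have hca : ContDiffAt ℝ n (U (T₁ + β * z.1) ∘ ⇑e) z.2 := by
      refine ContDiffAt.comp z.2 ?_ e.contDiff.contDiffAt
      rw [he]
      exact (hCD (T₁ + β * z.1, γ • z.2) ⟨hmaps1 z hz, hmaps2 z hz⟩).of_le
        (by exact_mod_cast le_top)
    rw [hU'fun, iteratedFDeriv_const_smul_apply hca, iteratedFDeriv_slice_comp_continuousLinearEquiv,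
      he]
  -- ### (i) the rescaled pair solves the unit-viscosity equations in `𝒟'(Ω')`
  have hsol' : IsDistributionalNSSolutionOn ⟨Ω', hΩ'o⟩ 1 0 U' π' := by
    have h := hsolU.stRescale hα hγ hαγ T₁ (0 : EuclideanSpace ℝ (Fin 3))
    have e1 : stPreimage β γ T₁ (0 : EuclideanSpace ℝ (Fin 3)) ⟨Ω, hΩo⟩ =
        (⟨Ω', hΩ'o⟩ : Opens (ℝ × EuclideanSpace ℝ (Fin 3))) := by
      refine TopologicalSpace.Opens.ext ?_
      show stAffine β γ T₁ (0 : EuclideanSpace ℝ (Fin 3)) ⁻¹' Ω = Ω'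
      rw [hΦst, hpre]
    have e3 : (α ^ 2 * γ) • stPull β γ T₁ (0 : EuclideanSpace ℝ (Fin 3))
        (0 : ℝ → EuclideanSpace ℝ (Fin 3) → EuclideanSpace ℝ (Fin 3)) = 0 := by
      funext s y
      simp [stPull_apply]
    rw [e1, hvisc, e3, ← hU'def, ← hπ'def] at h
    exact h
  -- ### (ii) `U' = w` a.e. on `Ω'`
  have hae' : uncurry U' =ᵐ[volume.restrict Ω'] uncurry w := by
    have h0 := ae_eq_restrict_comp_stAffine hβ hγ T₁ (0 : EuclideanSpace ℝ (Fin 3)) hae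
    rw [hΦst, hpre] at h0
    filter_upwards [h0] with z hz
    have hz' : U (T₁ + β * z.1) (γ • z.2) = u (T₁ + β * z.1) (γ • z.2) := hz
    show U' z.1 z.2 = w z.1 z.2
    rw [hU'app, hwapp, hz']
  -- ### (iii) the slices of `w` tend weakly to zero at the top time `s = 0`
  have htop : ∀ φ : EuclideanSpace ℝ (Fin 3) → EuclideanSpace ℝ (Fin 3),
      ContDiff ℝ (⊤ : ℕ∞) φ → HasCompactSupport φ → ∀ ε : ℝ, 0 < ε →
      ∃ s₀ : ℝ, s₀ < 0 ∧ ∀ᵐ s ∂(volume.restrict (Ioo s₀ 0)), |∫ y, ⟪w s y, φ y⟫| ≤ ε := by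
    intro φ hφ hφc ε hε
    -- the dilated test field `ψ = φ(·/γ)`
    set ψ : EuclideanSpace ℝ (Fin 3) → EuclideanSpace ℝ (Fin 3) := fun x => φ (γ⁻¹ • x)
      with hψdef
    have hψ : FunctionSpaces.IsTestFunctionOn (⊤ : Opens (EuclideanSpace ℝ (Fin 3))) ψ :=
      { contDiff := hφ.comp (contDiff_const_smul _)
        hasCompactSupport :=
          hφc.comp_homeomorph (Homeomorph.smulOfNeZero γ⁻¹ (inv_ne_zero hγ0))
        tsupport_subset := fun y _ => Opens.mem_top y }
    have hψγ : ∀ y, ψ (γ • y) = φ y := fun y => by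
      simp only [hψdef, inv_smul_smul₀ hγ0]
    -- the integral identity
    set c : ℝ := |(γ ^ Module.finrank ℝ (EuclideanSpace ℝ (Fin 3)))⁻¹| with hcdef
    have hc : 0 < c := by
      rw [hcdef, abs_pos]
      exact inv_ne_zero (pow_ne_zero _ hγ0)
    have hident : ∀ s, ∫ y, ⟪w s y, φ y⟫ =
        α * (c * ∫ x, ⟪u (T₁ + β * s) x, ψ x⟫) := by
      intro s
      have h1 : (fun y => ⟪w s y, φ y⟫) =
          fun y => α * (fun x => ⟪u (T₁ + β * s) x, ψ x⟫) (γ • y) := by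
        funext y
        simp only [hwapp, real_inner_smul_left, hψγ]
      rw [h1, integral_const_mul, Measure.integral_comp_smul volume
        (fun x => ⟪u (T₁ + β * s) x, ψ x⟫) γ, smul_eq_mul]
    -- the limit
    have hlim := hfinal ψ hψ
    rw [Metric.tendsto_nhdsWithin_nhds] at hlim
    have hε' : 0 < ε / (α * c) := div_pos hε (mul_pos hα hc)
    obtain ⟨δ, hδ, hδε⟩ := hlim (ε / (α * c)) hε'
    refine ⟨-(δ / β), by rw [neg_lt_zero]; exact div_pos hδ hβ, ?_⟩
    refine (ae_restrict_iff' measurableSet_Ioo).2 (ae_of_all _ fun s hs => ?_)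
    have hsδ : -s * β < δ := by
      have h : -s < δ / β := by linarith [hs.1]
      exact (lt_div_iff₀ hβ).1 h
    have hs1 : T₁ + β * s ∈ Iio T₁ := by
      show T₁ + β * s < T₁
      nlinarith [hs.2]
    have hs2 : dist (T₁ + β * s) T₁ < δ := by
      rw [Real.dist_eq, add_sub_cancel_left, abs_mul, abs_of_pos hβ, abs_of_neg hs.2]
      linarith [mul_comm (-s) β]
    have h3 := hδε hs1 hs2
    rw [Real.dist_eq, sub_zero] at h3
    rw [hident, abs_mul, abs_mul, abs_of_pos hα, abs_of_pos hc]
    have h4 : α * (c * |∫ x, ⟪u (T₁ + β * s) x, ψ x⟫|) ≤ α * (c * (ε / (α * c))) := by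
      gcongr
    refine h4.trans (le_of_eq ?_)
    field_simp
  -- ### (iv) regularity of the rescaled representative
  have hU4' : ∀ s ∈ Ioo (-1 : ℝ) 0, ContDiffOn ℝ 4 (U' s) S' := by
    intro s hs
    have ht : T₁ + β * s ∈ Ioo T₄ T₁ := by
      refine ⟨?_, by nlinarith [hs.2, hβ]⟩
      rw [hβdef]
      nlinarith [hs.1, hβ, hβdef]
    rw [hU'fun]
    exact ((hUS _ ht).comp e.contDiff.contDiffOn (fun y hy => hmapsγ hy)).const_smul α
  have hΦ' : ∀ n ≤ 4, ContinuousOn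
      (fun z : ℝ × EuclideanSpace ℝ (Fin 3) => iteratedFDeriv ℝ n (U' z.1) z.2) Ω' := by
    intro n _
    have hg : ContinuousOn (fun z : ℝ × EuclideanSpace ℝ (Fin 3) =>
        α • (iteratedFDeriv ℝ n (U (T₁ + β * z.1)) (γ • z.2)).compContinuousLinearMap
          fun _ => (e : EuclideanSpace ℝ (Fin 3) →L[ℝ] EuclideanSpace ℝ (Fin 3))) Ω' := by
      have h1 : ContinuousOn (fun z : ℝ × EuclideanSpace ℝ (Fin 3) =>
          iteratedFDeriv ℝ n (U (T₁ + β * z.1)) (γ • z.2)) Ω' :=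
        (hjc n).comp hΦc.continuousOn hmaps
      exact ((ContinuousMultilinearMap.continuous_precomp
        (fun _ : Fin n => (e : EuclideanSpace ℝ (Fin 3) →L[ℝ] EuclideanSpace ℝ (Fin 3)))
          ).comp_continuousOn h1).const_smul α
    exact hg.congr fun z hz => hformula n z hz
  -- the uniform bound `K' = α K₀ G³`, `G = max 1 γ`
  set G : ℝ := max 1 γ with hGdef
  have hG1 : 1 ≤ G := le_max_left _ _
  have hγG : γ ≤ G := le_max_right _ _
  set K' : ℝ := α * K₀ * G ^ 3 with hK'def
  have hK'bd : ∀ n ≤ 3, ∀ z ∈ Ω', ‖iteratedFDeriv ℝ n (U' z.1) z.2‖ ≤ K' := by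
    intro n hn z hz
    rw [hformula n z hz, norm_smul, Real.norm_of_nonneg hα.le]
    have h1 : ‖(iteratedFDeriv ℝ n (U (T₁ + β * z.1)) (γ • z.2)).compContinuousLinearMap
        fun _ => (e : EuclideanSpace ℝ (Fin 3) →L[ℝ] EuclideanSpace ℝ (Fin 3))‖ ≤ K₀ * G ^ 3 := by
      refine (ContinuousMultilinearMap.norm_compContinuousLinearMap_le _ _).trans ?_
      rw [Finset.prod_const, Finset.card_univ, Fintype.card_fin]
      have h2 : ‖iteratedFDeriv ℝ n (U (T₁ + β * z.1)) (γ • z.2)‖ ≤ K₀ :=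
        hbdK' n (by omega) (T₁ + β * z.1, γ • z.2) ⟨hmaps1 z hz, hmaps2 z hz⟩
      have h3 : ‖(e : EuclideanSpace ℝ (Fin 3) →L[ℝ] EuclideanSpace ℝ (Fin 3))‖ ^ n ≤ G ^ 3 :=
        calc ‖(e : EuclideanSpace ℝ (Fin 3) →L[ℝ] EuclideanSpace ℝ (Fin 3))‖ ^ n ≤ G ^ n :=
              pow_le_pow_left₀ (norm_nonneg _) (henorm.trans hγG) n
          _ ≤ G ^ 3 := pow_le_pow_right₀ hG1 hn
      exact mul_le_mul h2 h3 (pow_nonneg (norm_nonneg _) _) hK₀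
    calc α * ‖(iteratedFDeriv ℝ n (U (T₁ + β * z.1)) (γ • z.2)).compContinuousLinearMap
          fun _ => (e : EuclideanSpace ℝ (Fin 3) →L[ℝ] EuclideanSpace ℝ (Fin 3))‖
        ≤ α * (K₀ * G ^ 3) := mul_le_mul_of_nonneg_left h1 hα.le
      _ = K' := by rw [hK'def]; ring
  -- ### (v) backward uniqueness in the class `C¹ ∩ {∂ₓω ∈ C¹}`: `curl U' = 0` beyond `R' + 1`
  have hzero : ∀ z ∈ Ioo (-1 : ℝ) 0 ×ˢ {y : EuclideanSpace ℝ (Fin 3) | R' + 1 < ‖y‖},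
      curl (U' z.1) z.2 = 0 :=
    farField_curl_eq_zero hR' htop hae' hsol' hU4' hΦ' hK'bd
  -- ### (vi) back to `U`: `curl U(t, ·) = 0` on `{x₃ > R + γ}`
  have hcoord : ∀ x : EuclideanSpace ℝ (Fin 3), x 2 ≤ ‖x‖ := fun x => by
    have h := PiLp.norm_apply_le x (2 : Fin 3)
    rw [Real.norm_eq_abs] at h
    exact (le_abs_self _).trans h
  refine ⟨R + γ, U, fun t ht => ?_, ?_, fun t ht x hx => ?_⟩
  · -- `C¹` slices on the half-space region
    refine ((hUS t ht).of_le (by norm_num)).mono fun x hx => ?_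
    show x ∉ closedBall (0 : EuclideanSpace ℝ (Fin 3)) R
    rw [mem_closedBall, dist_zero_right, not_le]
    have : R + γ < x 2 := hx
    linarith [hcoord x]
  · -- the a.e. identity on the smaller region
    refine ae_restrict_of_ae_restrict_of_subset (prod_mono Subset.rfl fun x hx => ?_) hae
    show x ∉ closedBall (0 : EuclideanSpace ℝ (Fin 3)) R
    rw [mem_closedBall, dist_zero_right, not_le]
    have : R + γ < x 2 := hx
    linarith [hcoord x]
  · -- the vorticity: undo the scaling
    have hxn : R + γ < ‖x‖ := lt_of_lt_of_le hx (hcoord x)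
    have hxS : x ∈ S := by
      show x ∉ closedBall (0 : EuclideanSpace ℝ (Fin 3)) R
      rw [mem_closedBall, dist_zero_right, not_le]
      linarith
    -- the rescaled point `(s, y)`
    set s : ℝ := (t - T₁) / β with hsdef
    have hts : T₁ + β * s = t := by rw [hsdef]; field_simp; ring
    have hs : s ∈ Ioo (-1 : ℝ) 0 := by
      rw [hsdef]
      constructor
      · rw [lt_div_iff₀ hβ]; rw [hβdef]; linarith [ht.1]
      · rw [div_lt_iff₀ hβ]; linarith [ht.2]
    set y : EuclideanSpace ℝ (Fin 3) := γ⁻¹ • x with hydef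
    have hyx : γ • y = x := by rw [hydef, smul_inv_smul₀ hγ0]
    have hy : R' + 1 < ‖y‖ := by
      rw [hydef, norm_smul, norm_inv, Real.norm_of_nonneg hγ.le, hR'def, ← div_eq_inv_mul,
        lt_div_iff₀ hγ]
      nlinarith [hxn, div_mul_cancel₀ R hγ0]
    have h0 := hzero (s, y) ⟨hs, hy⟩
    simp only at h0
    -- `curl U'(s, ·)(y) = αγ • curl U(t, ·)(x)`
    have hdU : DifferentiableAt ℝ (U t) x :=
      ((hCD (t, x) ⟨ht, hxS⟩).differentiableAt (by simp)).differentiableWithinAt.differentiableAt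
        (hSo.mem_nhds hxS)
    have hderiv : HasFDerivAt (U' s)
        (α • (fderiv ℝ (U t) x).comp
          (γ • ContinuousLinearMap.id ℝ (EuclideanSpace ℝ (Fin 3)))) y := by
      rw [hU'fun, hts]
      have h1 : HasFDerivAt (fun y : EuclideanSpace ℝ (Fin 3) => γ • y)
          (γ • ContinuousLinearMap.id ℝ (EuclideanSpace ℝ (Fin 3))) y :=
        (hasFDerivAt_id y).const_smul γ
      have h2 : HasFDerivAt (U t) (fderiv ℝ (U t) x) (γ • y) := by
        rw [hyx]; exact hdU.hasFDerivAt
      exact (h2.comp y h1).const_smul α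
    have hcomp : (fderiv ℝ (U t) x).comp (γ • ContinuousLinearMap.id ℝ (EuclideanSpace ℝ (Fin 3)))
        = γ • fderiv ℝ (U t) x := by
      ext1 v
      simp
    have hcurl : curl (U' s) y = (α * γ) • curl (U t) x := by
      rw [curl_eq_curlCLM, curl_eq_curlCLM, hderiv.fderiv, hcomp, smul_smul, map_smul]
    rw [hcurl] at h0
    exact (smul_eq_zero.1 h0).resolve_left hαγ0

/-! ### Thm. 15.4 on a slab, arbitrary datum -/

/-- **Backward uniqueness for slab local Leray solutions with an arbitrary weakly
divergence-free datum, unit viscosity** (Lemarié-Rieusset 2016, Thm. 15.4, through the route of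
Escauriaza–Seregin–Šverák 2003, §5 and Seregin 2012, §4): a local Leray solution `(v, π)` on
`(0, T) × ℝ³` at unit viscosity whose pairings with test fields tend to `0` as `t ↑ T` vanishes
a.e. on the slab. Word for word the tree's `IsLocalLeraySolutionOn.ae_zero_of_final_vanishing_unit`
(far-field vanishing of the vorticity and the far-field bound, a.e. time is regular by CKN,
bounded strips around regular times, `ae_zero_strip_of_farField_curl_eq_zero` on each, countably
many strips), with the two far-field inputs in their arbitrary-datum form
(`localLeray_farField_curl_eq_zero_slab_anyDatum`, `farField_bound_anyDatum`).
[cite: LemarieRieusset2016, Thm. 15.4 (PDF p. 568)] [cite: EscauriazaSereginSverak2003, §5] [cite: Seregin2012CMP, §4] -/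
theorem IsLocalLeraySolutionOn.ae_zero_of_final_vanishing_unit_anyDatum {T : ℝ} (hT : 0 < T)
    {u₀ : EuclideanSpace ℝ (Fin 3) → EuclideanSpace ℝ (Fin 3)}
    {v : ℝ → EuclideanSpace ℝ (Fin 3) → EuclideanSpace ℝ (Fin 3)}
    {π : ℝ → EuclideanSpace ℝ (Fin 3) → ℝ}
    (hdiv : IsWeaklyDivFree u₀) (hv : IsLocalLeraySolutionOn T 1 u₀ v π)
    (hfinal : ∀ φ : EuclideanSpace ℝ (Fin 3) → EuclideanSpace ℝ (Fin 3),
      FunctionSpaces.IsTestFunctionOn (⊤ : Opens (EuclideanSpace ℝ (Fin 3))) φ →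
        Tendsto (fun t => ∫ x, ⟪v t x, φ x⟫) (𝓝[<] T) (𝓝 0)) :
    ∀ᵐ z ∂(volume.restrict (Ioo 0 T ×ˢ (univ : Set (EuclideanSpace ℝ (Fin 3))))),
      v z.1 z.2 = 0 := by
  -- it suffices to treat the slabs `(T₄, T) × ℝ³`, `T₄ = T/(n+2)`
  suffices hmain : ∀ T₄ ∈ Ioo 0 T,
      ∀ᵐ z ∂(volume.restrict (Ioo T₄ T ×ˢ (univ : Set (EuclideanSpace ℝ (Fin 3))))),
        v z.1 z.2 = 0 by
    have hn : ∀ n : ℕ, ∀ᵐ z ∂(volume.restrict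
        (Ioo (T / (n + 2)) T ×ˢ (univ : Set (EuclideanSpace ℝ (Fin 3))))), v z.1 z.2 = 0 :=
      fun n => hmain _ ⟨by positivity, div_lt_self hT (by norm_cast; omega)⟩
    have hU : Ioo 0 T ×ˢ (univ : Set (EuclideanSpace ℝ (Fin 3))) =
        ⋃ n : ℕ, Ioo (T / (n + 2)) T ×ˢ (univ : Set (EuclideanSpace ℝ (Fin 3))) := by
      ext ⟨t, x⟩
      simp only [mem_prod, mem_Ioo, mem_univ, and_true, mem_iUnion]
      constructor
      · rintro ⟨ht0, htT⟩
        obtain ⟨n, hn⟩ := exists_nat_gt (T / t)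
        refine ⟨n, ?_, htT⟩
        have h1 : T < (n : ℝ) * t := (div_lt_iff₀ ht0).1 hn
        rw [div_lt_iff₀ (by positivity)]
        nlinarith
      · rintro ⟨n, h1, h2⟩
        exact ⟨lt_trans (by positivity) h1, h2⟩
    rw [hU, ae_restrict_iUnion_iff]
    exact hn
  intro T₄ hT₄
  have hI₄ : Ioo T₄ T ⊆ Ioo 0 T := Ioo_subset_Ioo hT₄.1.le le_rfl
  -- ### the far field: vanishing vorticity (Steps 2–3 of the printed proof) and the `L^∞` bound
  obtain ⟨Rf, Uf, hUf1, hUfv, hcurl⟩ :=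
    localLeray_farField_curl_eq_zero_slab_anyDatum
      NSBoundedHigherRegularityBounds_holds one_pos hdiv hv hfinal hT₄
  obtain ⟨Rb, hRb⟩ :=
    hv.farField_bound_anyDatum one_pos hT₄.1 (le_refl T)
  have hfar := ae_norm_le_toReal_of_eLpNorm_top_lt_top hRb
  -- ### a.e. time is regular; around each regular time a strip where `v` vanishes
  have hreg : ∀ᵐ t ∂(volume.restrict (Ioo T₄ T)), ∀ x : EuclideanSpace ℝ (Fin 3),
      IsRegularPoint v (t, x) :=
    ae_restrict_of_ae_restrict_of_subset hI₄ (ae_forall_isRegularPoint_slab one_pos hv.suitable)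
  have hstrip : ∀ᵐ t ∂(volume.restrict (Ioo T₄ T)), ∃ q : ℚ × ℚ, t ∈ Ioo (q.1 : ℝ) q.2 ∧
      ∀ᵐ z ∂(volume.restrict (Ioo (q.1 : ℝ) q.2 ×ˢ (univ : Set (EuclideanSpace ℝ (Fin 3))))),
        v z.1 z.2 = 0 := by
    filter_upwards [hreg, ae_restrict_mem measurableSet_Ioo] with t ht htI
    obtain ⟨τ, hτ, hsubτ, L, hL⟩ := exists_strip_bound_Ioo hfar (fun x _ => ht x) htI
    obtain ⟨h1, h2⟩ := (Ioo_subset_Ioo_iff (by linarith : t - τ < t + τ)).1 hsubτ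
    -- the strip lemma on `(t - τ, t + τ/2)`, which vanishes on `(t - τ/4, t + τ/2) ∋ t`
    have ha : 0 < t - τ := lt_of_lt_of_le hT₄.1 h1
    have hab : t - τ < t + τ / 2 := by linarith
    have hbT : t + τ / 2 ≤ T := by linarith
    have hJ : Ioo (t - τ) (t + τ / 2) ⊆ Ioo T₄ T := Ioo_subset_Ioo h1 (by linarith)
    have hbd : ∀ᵐ z ∂(volume.restrict
        (Ioo (t - τ) (t + τ / 2) ×ˢ (univ : Set (EuclideanSpace ℝ (Fin 3))))), ‖v z.1 z.2‖ ≤ L :=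
      ae_restrict_of_ae_restrict_of_subset
        (prod_mono (Ioo_subset_Ioo le_rfl (by linarith)) Subset.rfl) hL
    have hz := ae_zero_strip_of_farField_curl_eq_zero NSBoundedHigherRegularityBounds_holds
      kangMiuraTsai_local_pressure_bound_holds hdiv hv ha hab hbT hbd
      (fun s hs => hUf1 s (hJ hs))
      (ae_restrict_of_ae_restrict_of_subset (prod_mono hJ Subset.rfl) hUfv)
      (fun s hs x hx => hcurl s (hJ hs) x hx)
    obtain ⟨q₁, hq₁a, hq₁t⟩ := exists_rat_btwn (show t - τ / 4 < t by linarith)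
    obtain ⟨q₂, hq₂t, hq₂b⟩ := exists_rat_btwn (show t < t + τ / 2 by linarith)
    refine ⟨(q₁, q₂), ⟨hq₁t, hq₂t⟩, ae_restrict_of_ae_restrict_of_subset (prod_mono
      (Ioo_subset_Ioo (by linarith) hq₂b.le) Subset.rfl) hz⟩
  -- ### the countable union of the good rational strips carries a.e. every time
  set G : Set (ℚ × ℚ) := {q | ∀ᵐ z ∂(volume.restrict
    (Ioo (q.1 : ℝ) q.2 ×ˢ (univ : Set (EuclideanSpace ℝ (Fin 3))))), v z.1 z.2 = 0} with hG
  set S : Set ℝ := ⋃ q ∈ G, Ioo (q.1 : ℝ) q.2 with hSdef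
  have hS : ∀ᵐ z ∂(volume.restrict (S ×ˢ (univ : Set (EuclideanSpace ℝ (Fin 3))))),
      v z.1 z.2 = 0 := by
    have e : S ×ˢ (univ : Set (EuclideanSpace ℝ (Fin 3))) =
        ⋃ q ∈ G, Ioo (q.1 : ℝ) q.2 ×ˢ (univ : Set (EuclideanSpace ℝ (Fin 3))) := by
      rw [hSdef]
      simp only [iUnion_prod_const]
    rw [e, ae_restrict_biUnion_iff _ (Set.to_countable G)]
    exact fun q hq => hq
  have hnull : volume (Ioo T₄ T \ S) = 0 := by
    refine measure_eq_zero_iff_ae_notMem.2 ?_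
    have h := (ae_restrict_iff' measurableSet_Ioo).1 hstrip
    filter_upwards [h] with t ht hmem
    obtain ⟨q, hq, hqG⟩ := ht hmem.1
    exact hmem.2 (mem_iUnion₂.2 ⟨q, hqG, hq⟩)
  -- ### conclusion
  have hcover : Ioo T₄ T ×ˢ (univ : Set (EuclideanSpace ℝ (Fin 3))) ⊆
      S ×ˢ (univ : Set (EuclideanSpace ℝ (Fin 3))) ∪
        (Ioo T₄ T \ S) ×ˢ (univ : Set (EuclideanSpace ℝ (Fin 3))) := by
    rintro ⟨t, x⟩ ⟨ht, -⟩
    by_cases hts : t ∈ S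
    · exact Or.inl ⟨hts, mem_univ _⟩
    · exact Or.inr ⟨⟨ht, hts⟩, mem_univ _⟩
  refine ae_restrict_of_ae_restrict_of_subset hcover ?_
  rw [ae_restrict_union_iff]
  refine ⟨hS, ?_⟩
  have h0 : volume ((Ioo T₄ T \ S) ×ˢ (univ : Set (EuclideanSpace ℝ (Fin 3)))) = 0 := by
    rw [Measure.volume_eq_prod, Measure.prod_prod, hnull, zero_mul]
  rw [Measure.restrict_eq_zero.2 h0, ae_zero]
  exact eventually_bot

/-- **Backward uniqueness for slab local Leray solutions with an arbitrary weakly divergence-free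
datum, viscosity `ν > 0`** (Lemarié-Rieusset 2016, Thm. 15.4, PDF p. 568, the `L³` hypothesis on
the datum removed): if `(v, π)` is a local Leray solution on `(0, T) × ℝ³` with viscosity `ν` and
weakly divergence-free datum `u₀`, and `∫⟪v(t), φ⟫ → 0` as `t ↑ T` for every test field `φ`, then
`v = 0` a.e. on `(0, T) × ℝ³`. From the unit-viscosity statement by the slab viscosity scaling
`IsLocalLeraySolutionOn.toUnitViscosity` (`ṽ(s, y) = ν⁻¹ v(ν⁻¹ s, y)` on `(0, νT)`), exactly as in
the tree's `ae_zero_of_final_vanishing`. [cite: LemarieRieusset2016, Thm. 15.4 (PDF p. 568)] -/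
theorem IsLocalLeraySolutionOn.ae_zero_of_final_vanishing_anyDatum {ν T : ℝ} (hν : 0 < ν)
    (hT : 0 < T) {u₀ : EuclideanSpace ℝ (Fin 3) → EuclideanSpace ℝ (Fin 3)}
    {v : ℝ → EuclideanSpace ℝ (Fin 3) → EuclideanSpace ℝ (Fin 3)}
    {π : ℝ → EuclideanSpace ℝ (Fin 3) → ℝ}
    (hdiv : IsWeaklyDivFree u₀) (hv : IsLocalLeraySolutionOn T ν u₀ v π)
    (hfinal : ∀ φ : EuclideanSpace ℝ (Fin 3) → EuclideanSpace ℝ (Fin 3),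
      FunctionSpaces.IsTestFunctionOn (⊤ : Opens (EuclideanSpace ℝ (Fin 3))) φ →
        Tendsto (fun t => ∫ x, ⟪v t x, φ x⟫) (𝓝[<] T) (𝓝 0)) :
    ∀ᵐ z ∂(volume.restrict (Ioo 0 T ×ˢ (univ : Set (EuclideanSpace ℝ (Fin 3))))),
      v z.1 z.2 = 0 := by
  have hw := hv.toUnitViscosity hν
  have hdiv' : IsWeaklyDivFree (ν⁻¹ • u₀) := hdiv.const_smul _
  have hνT : 0 < ν * T := mul_pos hν hT
  -- the final-value hypothesis for the normalised solution
  have hfinal' : ∀ φ : EuclideanSpace ℝ (Fin 3) → EuclideanSpace ℝ (Fin 3),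
      FunctionSpaces.IsTestFunctionOn (⊤ : Opens (EuclideanSpace ℝ (Fin 3))) φ →
        Tendsto (fun s => ∫ x, ⟪FluidPDE.timeRescale ν⁻¹ ν⁻¹ v s x, φ x⟫)
          (𝓝[<] (ν * T)) (𝓝 0) := by
    intro φ hφ
    have e : (fun s => ∫ x, ⟪FluidPDE.timeRescale ν⁻¹ ν⁻¹ v s x, φ x⟫) =
        fun s => ν⁻¹ * ∫ x, ⟪v (ν⁻¹ * s) x, φ x⟫ := by
      funext s
      simp only [timeRescale_apply, real_inner_smul_left]
      exact integral_const_mul _ _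
    rw [e]
    have hmap : Tendsto (fun s : ℝ => ν⁻¹ * s) (𝓝[<] (ν * T)) (𝓝[<] T) := by
      have hc : ContinuousWithinAt (fun s : ℝ => ν⁻¹ * s) (Iio (ν * T)) (ν * T) :=
        (continuous_const.mul continuous_id).continuousWithinAt
      have hm : MapsTo (fun s : ℝ => ν⁻¹ * s) (Iio (ν * T)) (Iio T) := by
        intro s hs
        have h : ν⁻¹ * s < ν⁻¹ * (ν * T) := mul_lt_mul_of_pos_left hs (inv_pos.2 hν)
        rwa [← mul_assoc, inv_mul_cancel₀ hν.ne', one_mul] at h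
      have h := hc.tendsto_nhdsWithin hm
      rwa [← mul_assoc, inv_mul_cancel₀ hν.ne', one_mul] at h
    have h := ((hfinal φ hφ).comp hmap).const_mul ν⁻¹
    rw [mul_zero] at h
    exact h
  have h := IsLocalLeraySolutionOn.ae_zero_of_final_vanishing_unit_anyDatum hνT hdiv' hw hfinal'
  -- transport back along `(t, x) ↦ (ν t, x)`
  have h2 := ae_restrict_preimage_stAffine hν one_pos 0 (0 : EuclideanSpace ℝ (Fin 3)) h
  rw [stAffine_preimage_Ioo_zero_prod hν T] at h2
  filter_upwards [h2] with z hz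
  have hz' : ν⁻¹ • v (ν⁻¹ * (0 + ν * z.1)) (0 + (1 : ℝ) • z.2) = 0 := hz
  rw [zero_add, zero_add, one_smul, ← mul_assoc, inv_mul_cancel₀ hν.ne', one_mul] at hz'
  exact (smul_eq_zero.1 hz').resolve_left (inv_ne_zero hν.ne')

end Literature.Analysis.FluidPDE

end
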